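import Summits.CriticalPhenomena.SAWScalingLimit.Theorems.SAWMassiveIsingTiltLatticeUniversalityNoTightness
import Summits.CriticalPhenomena.SAWScalingLimit.Theorems.SAWMassiveIsingTiltLatticeUniversalityKernelUnderTransport
import Summits.CriticalPhenomena.SAWScalingLimit.Theorems.SAWMassiveIsingTiltLatticeUniversalityKernelSplit
import Summits.CriticalPhenomena.SAWScalingLimit.Theorems.SAWMassiveIsingTiltLatticeUniversalityKernelMonolayer
import Summits.CriticalPhenomena.SAWScalingLimit.Theorems.SAWMassiveIsingTiltLatticeUniversalityMonolayerGlue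
import Summits.CriticalPhenomena.SAWScalingLimit.Theorems.SAWMassiveIsingTiltLatticeUniversalityAdmissibleTips
import Summits.CriticalPhenomena.SAWScalingLimit.Theorems.SAWMassiveIsingTiltLatticeUniversalityThirdEndpoints
import Summits.CriticalPhenomena.SAWScalingLimit.Theses.SAWHexUniversality
import Summits.CriticalPhenomena.SAWScalingLimit.Theses.SAWResidueField
import Summits.CriticalPhenomena.SAWScalingLimit.Theses.SAWBetheAnsatz
import Summits.CriticalPhenomena.SAWScalingLimit.Theses.SAWLatticeVirasoro
import Summits.CriticalPhenomena.SAWScalingLimit.Theses.SAWTiltedExplorer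
import Summits.CriticalPhenomena.SAWScalingLimit.Theses.SAWTurnDefect

/-!
# Skeleton v4.5 for the crux `LatticeUniversality` (stmt-CriticalPhenomena-0807) — line `registered` (= `birth`):
# the Yang–Baxter relay run in the ROTATED AND HALF-SHIFTED domain, upgraded against the CONVERGENT Yang–Baxter side;
# the hexagonal kernel SPLIT into (E*) endpoint robustness ∧ (L*) one good vertex approximation per domain,
# and (L*) made CONCRETE: the monolayer statement (MONO) + a provable admissible-tips stub + glue
(line leads prover-line-stmt-CriticalPhenomena-0807-c1-0 (v1 → v3.2), -c2-0 (v3.3/v3.4), -c3-0 (unification),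
-c4-0 (v4/v4.1), -c5-0 (v4.2, kernel pinned and split), -c6-0 (v4.2 tree copy; v4.3; v4.4/v4.5 = v4.3 with the glue and admissible-tips stubs closed, p172557 / W1), 2026-08-17; v1 = the registrar's
`Lines/birth.lean`, planner-skel-stmt-CriticalPhenomena-0807-0.)

v4.2 (c5; this tree copy written by c6 — c5 registered v4.2 with `ledger skeleton check` at 14:44Z but its `crux write`
met a farm outage, so the tree still showed v4.1): the registered research stub of v4.1, VCR (`HexVertexRobust`), is no
longer a stub but DERIVED (`hexVertexRobust_of_stubs`) from two registered stubs of different standing, via the landed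
`hexVertexRobust_of_endpoint_layer` (`Theorems/…KernelSplit.lean`, p167072):
* `stub_hexEndpointRobust` — (E*) `HexEndpointRobust`: hexagonal only, vertex convention, limit-free, GM-free: any two
  hexagonal endpoint approximations of one Dobrushin domain give critical chordal laws merging on bounded `1`-Lipschitz
  test functions. NECESSARY FOR THE CRUX UNCONDITIONALLY (`hexEndpointRobust_of_latticeUniversality`, p167072) and implied
  by (A) (`hexEndpointRobust_of_hexConjecture`); promoted by c5 (`PROMOTE-addendum-c5.md`).
* `stub_hexLayerRobust` — (L*) `HexLayerRobust` (∃-form): for every chordal `P` with `RL(π/3) P` and every `D`, SOME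
  hexagonal endpoint approximation of `D` has σ-pushed vertex-convention laws converging to `P (σD)` — the boundary
  MONOLAYER statement (inner-cell versus vertex discretisation of one domain from the same boundary tips), the relay's
  own artefact; necessary granted the transport items (`latticeUniversality_iff_endpoint_layer`, p167072).
Granted stmt-16995 (ii), 16963, 16966: LatticeUniversality ↔ VCR ↔ K2∀ ↔ (E*) ∧ (L*) (p165464, p167072).

v4.3 (c6): (L*) quantifies over an unidentified limit object `P`; its CONTENT is the boundary monolayer. v4.3 reshapes the
registered stub `stub_hexLayerRobust` at skeleton level into three registered stubs and DERIVES (L*) from them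
(`hexLayerRobust_of_stubs'`):
* `stub_hexMonolayer` — (MONO) `HexMonolayer` (RESEARCH, lead holds): P-free, limit-free, one approximation type — for every
  family of boundary mid-edges of the face sets of `S_δ(D)` (eventual clause of K2∀) WHOSE BOUNDARY-TRIANGLE TIPS ARE AN
  ADMISSIBLE hexagonal endpoint approximation of `D`, the critical hexagonal laws of the FACE DOMAIN (inner-cell discretisation
  of `D`) and of `D` (vertex discretisation), both between the SAME tips, merge on bounded `1`-Lipschitz functions. It is the
  diagonal of K2∀ (K2∀ → MONO), hence necessary for the crux granted stubs 2–4; it is what a disprover or a Monte-Carlo job can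
  attack directly.
* `stub_admissibleTips` (PROVABLE; CLOSED in v4.5 — worker W1): a bulk-attached boundary approximation of the face sets of `S_δ(D)` whose tips
  ARE admissible for `D` (p147051's construction with a fixed interior point in the bulk set + the largest-component lemma
  `exists_forall_mem_hexMeshDomain_and_reachable` + the face-domain mesh dictionary `embMeshDomain_faceDomain_eq`).
* `stub_monolayerGlue` (PROVABLE; CLOSED in v4.4 — worker W2, p172557): MONO → AdmissibleTips → (L*) (the K2∀ → VCR proof `tendstoLaw_hexLaw_of_allForm_robustThird`,
  p156087, run on the diagonal `(a, b) := tips`).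
Cost of the crux on this line after v4.5: 0807 ⇐ {(E*), (MONO)} ∪ {16995 (ii), 16963, 16966} — the two provable stubs are closed; granted the
three transport items 0807 ↔ (E*) ∧ (MONO) (`latticeUniversality_iff_endpoint_monolayer`, `Theorems/…KernelConcrete.lean`).

Crux (route `SAWMassiveIsingTilt`, rank 4; identical body in `SAWHexUniversality`, `SAWResidueField`,
`SAWBetheAnsatz`, `SAWLatticeVirasoro`, `SAWTiltedExplorer`, `SAWTurnDefect`):

  `LatticeUniversality := ∀ D (a b : ℝ → Site 2) (a' b' : ℝ → HexVertex), IsEndpointApprox D a b →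
     IsEmbEndpointApprox hexGraph hexCenter D a' b' → ∀ f : CurveClass ℂ →ᵇ ℝ,
     Tendsto (fun δ => ∫ f∘curve dP^{ℤ²}_δ − ∫ f∘curve dP^{Hex}_δ) (𝓝[>] 0) (𝓝 0)`.

THE LINE (unchanged idea): cut `P^{ℤ²} − P^{Hex}` along Glazman–Manolescu's Yang–Baxter family (arXiv:1708.00395:
the critical GM walk on `H(π/3)` IS the hexagonal SAW; law-level transport inside the family = DKKMO arXiv:2012.11672
Thm 2.1 at `n = 0`; then the off-family toll to uniform `δℤ²`). History of the reshapes (cards `Lines/birth.md`,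
`PICKED.md`; analyses `K2-ANALYSIS-c2.md`, `UNIFICATION-c3.md`):
(F1, c1) ORIENTATION — `hexSAWLaw` runs on `δ·hexCenter` (honeycomb `H₀`), the GM `π/3` walk on `S_δ(δH₀)`,
`S_δ z = i z − iδ/2` (`gmSimilarity`); the quarter turn `σ z = i z` is inserted at the `δℤ²` end where it is an EXACT
lattice symmetry (`integral_quarterTurn`, p143793). (F1′, c1) HALF PERIOD — the `π/3` GM law is put in the MOVING domain
`S_δ(D) = σD − iδ/2`; the exact `π/3` dictionary (`stub_gmHexDictionary`, crux 14221) identifies it with the hexagonal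
law of a face domain `⊆ D` on the SAME lattice; the sub-mesh shift rides on route SAWTrackTransport's robust limits `RL`,
which carry `O(δ)`-moving domains by design. (F2, c1) MERGING WITHOUT TIGHTNESS is strong merging; v3 factored ONE
tightness stub (`HexTight` = stmt-5423) + bounded-Lipschitz stubs + the merging upgrade (p144690). (c2) the hexagonal
residue cut into the provable `stub_shiftedBdryEndpoints` (p147051) and the ∀-form kernel K2∀ = `stub_hexMicroRobustAll`
(promoted: `PROMOTE-stub_hexMicroRobustAll.md`). (c3) under (A) no tightness is needed and K2∀ serves crux 14221 too
(p153935, p154406).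

v4 (THIS seat, c4): THE TIGHTNESS CRUX LEAVES THE LINE, (A)-FREE. v3.4's transport stub was already reduced to
SAWTrackTransport's `YBLimitExists` (stmt-16995: a ROBUST FULL LIMIT `P` of the square-tiling walk, `RL(π/2) P`) and
`AngleUniversality` (stmt-16963: `RL(π/2) P → RL(π/3) P`) — and these make the YANG–BAXTER side of the relay CONVERGENT:
`RL(π/3)` sends the `π/3` laws of the moving domains `S_δ(D)` to `P (σD)`, `RL(π/2)` (at `u ≡ 0`) the square-tiling laws
of `σD`. Bounded-Lipschitz merging against a convergent family is merging on `C_b` (c3's `tendsto_integral_sub_of_tendstoLaw`,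
no Prokhorov), so: K2∀ + dictionary + `RL(π/3)` ⇒ `σ_* P^{Hex}_δ(D) → P(σD)` on `C_b` ((HexVL),
`tendstoLaw_hexLaw_of_allForm_robustThird`); toll + `RL(π/2)` + exact quarter turn ⇒ `P^{ℤ²}_δ(D) → σ⁻¹_* P(σD)` on
`C_b`; subtract. LANDED: `Theorems/SAWMassiveIsingTiltLatticeUniversalityNoTightness.lean`
(`latticeUniversality_of_allForm_trackTransport`, `…_robustLimits`, `…_robustSquare`, `hexLimit_of_allForm_robustSquare`).

v4.1 (THIS seat, c4): THE KERNEL IS RE-TYPED AT ITS WEAKEST SUFFICIENT FORM. The v4 composition consumes K2∀ ONLY through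
(HexVL)(P) — "the σ-pushed VERTEX-convention hexagonal laws of D converge to P(σD)". Hence the registered kernel becomes
VCR (`stub_hexVertexRobust`): for every CHORDAL family P that is the robust `π/3` limit of the Glazman–Manolescu walk
(`RL(π/3) P`, SAWTrackTransport's hypothesis verbatim), (HexVL)(P). Kernel-checked: K2∀ → VCR (`vcr_of_allForm`,
`hexVertexRobust_of_allForm` below) and, granted stubs 2–3, VCR → K2∀ (`allForm_of_vcr_robustThird`, worker W1, p157085;
`allForm_iff_vcr`): on this line the two typings are EQUIVALENT, VCR is the weaker standalone statement (any proof of K2∀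
closes it), and it hands its prover a limit object and translation robustness (moving domains `D + u δ`).

Registered stubs v4.5 (the ONLY sorries; Literature / Theses vocabulary only):
* `stub_hexEndpointRobust` — (E*) (RESEARCH, promoted by c5); `stub_hexMonolayer` — (MONO) (RESEARCH, lead holds)
  (`stub_admissibleTips`, `stub_monolayerGlue` closed: W1 / p172557) — see the v4.2/v4.3 paragraphs above; together they give
  (L*) and then VCR, v4.1's stub (vertex-convention robustness of the robust `π/3` limit; VCR is implied by the
  twice-promoted K2∀ `PROMOTE-stub_hexMicroRobustAll.md` and equivalent to it granted stubs 2–3).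
* `stub_ybRobustLimit` — conjunct (ii) of `SAWTrackTransport.YBLimitExists` (stmt-16995) verbatim: a chordal family `P`
  that is the ROBUST FULL LIMIT of the critical square-tiling Glazman–Manolescu walk (open-problem, staffed there; the
  endpoint-existence conjunct (i) of 16995 is not used by the relay).
* `stub_angleUniversality` = `SAWTrackTransport.AngleUniversality` (stmt-16963) verbatim (open-problem, staffed there).
* `stub_ybToUniform` = `SAWTrackTransport.YBtoUniform` (stmt-16966) verbatim — the off-family toll (open-problem).
GONE: `stub_hexTight` (= stmt-5423; v3.4's tightness stub — not needed), `stub_thirdToSquareRobustBL` (v3.4's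
bounded-Lipschitz difference form of the transport; it FOLLOWS from stubs 2–3, `thirdToSquareRobustBL_of_v4stubs` below,
and v3.4's tightness-factored composition through it stays in the tree, `latticeUniversality_of_allFormRelay` p150118,
for a future LIMIT-FREE proof of the transport — then `HexTight` would be needed again: `latticeUniversality_of_v34stubs`),
and `stub_hexMicroRobustAll` (K2∀; v3.3–v4's kernel, now the STRONGER sufficient form: `latticeUniversality_of_K2stubs`).

COMPOSITION (sorry-free): `LatticeUniversality_of_stubs` (the landed `latticeUniversality_of_allForm_robustLimits` with
(HexVL) supplied by VCR); `LatticeUniversality_of` concludes the crux BY NAME; the six sibling copies by the same term.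
Cost of the crux on this line: 0807 ⇐ {VCR (⇐ K2∀), 16995 (ii), 16963, 16966}. By-product (`hexLimit_of_stubs`): stubs 1–3 alone give the critical
hexagonal SAW (vertex convention) a full chordal scaling limit `D ↦ P(σD)` seen through `σ`.
-/

noncomputable section

namespace Summit.CriticalPhenomena.SAWScalingLimit.Cruxes.LatticeUniversality.Birth

open MeasureTheory Filter Topology Set
open scoped NNReal ENNReal BoundedContinuousFunction
open Complex (I I_ne_zero)
open Literature.Probability.RandomPlanarGeometry
open Literature.Probability.RandomPlanarGeometry.SAW
open Literature.Probability.RandomPlanarGeometry.SAW.YangBaxter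
open Literature.Probability.LatticeModels (Site HexVertex hexGraph hexCenter)
open Summit.CriticalPhenomena.SAWScalingLimit.Theses
open Summit.CriticalPhenomena.SAWScalingLimit.Cruxes.HexTransfer.YbRelay (third IsBdryEdge bdryVertex
  faceDomain gmSimilarity stub_gmHexDictionary)

/-! ### The stub statements (folded names, for the composition's readability) -/

/-- Stub 1 statement = crux `HexTight` (stmt-CriticalPhenomena-5423) verbatim: tightness along `𝓝[>] 0` of the
critical hexagonal chordal SAW curves, every Dobrushin domain, every endpoint approximation. [folklore] -/
def HexTightStmt : Prop :=
  ∀ (D : DobrushinDomain) (a b : ℝ → HexVertex), SAW.IsEmbEndpointApprox hexGraph hexCenter D a b →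
    IsTightAlongMesh (fun δ (γ : SAW.HexDomainSAW D.carrier δ (a δ) (b δ)) => γ.curve)
      (fun δ => SAW.hexSAWLaw D.carrier δ (a δ) (b δ))

/-- Stub 2 statement (**the convention bridge, rotated and half-shifted; bounded-Lipschitz, ∃-form**): for
every hexagonal endpoint approximation `(a, b)` of `D` there are mid-edges `(a', b')`, joined by GM walks of
the moving domains `S_δ(D) = σD − iδ/2` for small `δ` and with rescaled midpoints converging to the marked
points of `σD`, such that the critical Glazman–Manolescu law of `H(π/3)` in `S_δ(D)` and the `S_δ`-image of
the critical hexagonal law of `D` merge on bounded `1`-Lipschitz test functions. The GM `π/3` honeycomb at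
mesh `δ` IS `S_δ(δ·hexCenter)`: both walks live on one honeycomb, in discretisations of ONE domain.
[cite: GlazmanManolescu2019, §1 p. 3 and Fig. 2] -/
def HexThirdShiftBL : Prop :=
  ∀ (D : DobrushinDomain) (a b : ℝ → HexVertex), SAW.IsEmbEndpointApprox hexGraph hexCenter D a b →
    ∃ a' b' : ℝ → MidEdge,
      (∀ᶠ δ : ℝ in 𝓝[>] (0 : ℝ), Nonempty (YangBaxterSAW third
        (((D.map (similarity I I_ne_zero 0)).map
          (similarity 1 one_ne_zero (-(I * (δ : ℂ) / 2)))).carrier) δ (a' δ) (b' δ))) ∧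
      Tendsto (fun δ : ℝ => (δ : ℂ) * planeMidpoint third (a' δ)) (𝓝[>] (0 : ℝ))
        (𝓝 ((D.map (similarity I I_ne_zero 0)).pt 0)) ∧
      Tendsto (fun δ : ℝ => (δ : ℂ) * planeMidpoint third (b' δ)) (𝓝[>] (0 : ℝ))
        (𝓝 ((D.map (similarity I I_ne_zero 0)).pt 1)) ∧
      ∀ f : BoundedContinuousFunction (CurveClass ℂ) ℝ, LipschitzWith 1 f →
        Tendsto (fun δ : ℝ =>
            (∫ γ, f (γ.curve third δ)
                ∂(ybLaw third
                    (((D.map (similarity I I_ne_zero 0)).map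
                      (similarity 1 one_ne_zero (-(I * (δ : ℂ) / 2)))).carrier) δ 1 (a' δ) (b' δ))) -
              ∫ γ, f (CurveClass.map (gmSimilarity δ : C(ℂ, ℂ)) γ.curve)
                ∂(SAW.hexSAWLaw D.carrier δ (a δ) (b δ)))
          (𝓝[>] (0 : ℝ)) (𝓝 0)

/-- Stub 2 statement (**micro-robustness of the critical hexagonal chordal law**, hex-only, ∃-form,
bounded-Lipschitz; the research residue of the hexagonal end after v3's exact reductions): for every
hexagonal endpoint approximation `(a, b)` of `D` (vertex discretisation `embMeshDomain` of `D` on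
`δ·hexCenter`, endpoints of ANY admissible depth) there are mid-edges `(a', b')` — eventually distinct
boundary edges of the face sets of the moving domains `S_δ(D) = σD − iδ/2`, `σ z = i z`, joined by a GM walk,
with rescaled midpoints converging to the marked points of `σD` — such that the critical hexagonal laws of
(i) the FACE DOMAIN of `S_δ(D)` at `a' δ` (a sub-domain of `D`: the `S_δ`-preimage of the union of the closed
`δ`-rhombi inside `S_δ(D)`, i.e. the union of the closed two-triangle cells of `δ·(ℤ + ℤζ)` inside `D`; its
canonical discretisation on `δ·hexCenter` is the INNER-CELL discretisation of `D`) between the boundary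
triangles of `a' δ`, `b' δ`, and of (ii) `D` itself between `a δ` and `b δ`, merge on bounded `1`-Lipschitz
test functions. One domain, one lattice, no rotation, no shift, no limit assumed: inner-cell versus
vertex discretisation plus endpoint relocation. [folklore] -/
def HexMicroRobust : Prop :=
  ∀ (D : DobrushinDomain) (a b : ℝ → HexVertex), SAW.IsEmbEndpointApprox hexGraph hexCenter D a b →
    ∃ a' b' : ℝ → MidEdge,
      (∀ᶠ δ in 𝓝[>] (0 : ℝ), a' δ ≠ b' δ ∧
        IsBdryEdge (meshFaces third (((D.map (similarity I I_ne_zero 0)).map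
          (similarity 1 one_ne_zero (-(I * (δ : ℂ) / 2)))).carrier) δ) (a' δ) ∧
        IsBdryEdge (meshFaces third (((D.map (similarity I I_ne_zero 0)).map
          (similarity 1 one_ne_zero (-(I * (δ : ℂ) / 2)))).carrier) δ) (b' δ) ∧
        Nonempty (YangBaxterSAW third (((D.map (similarity I I_ne_zero 0)).map
          (similarity 1 one_ne_zero (-(I * (δ : ℂ) / 2)))).carrier) δ (a' δ) (b' δ))) ∧
      Tendsto (fun δ : ℝ => (δ : ℂ) * planeMidpoint third (a' δ)) (𝓝[>] (0 : ℝ))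
        (𝓝 ((D.map (similarity I I_ne_zero 0)).pt 0)) ∧
      Tendsto (fun δ : ℝ => (δ : ℂ) * planeMidpoint third (b' δ)) (𝓝[>] (0 : ℝ))
        (𝓝 ((D.map (similarity I I_ne_zero 0)).pt 1)) ∧
      ∀ f : BoundedContinuousFunction (CurveClass ℂ) ℝ, LipschitzWith 1 f →
        Tendsto (fun δ : ℝ =>
            (∫ γ, f γ.curve ∂(SAW.hexSAWLaw
                (faceDomain (((D.map (similarity I I_ne_zero 0)).map
                  (similarity 1 one_ne_zero (-(I * (δ : ℂ) / 2)))).carrier) δ (a' δ)) δ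
                (bdryVertex (meshFaces third (((D.map (similarity I I_ne_zero 0)).map
                  (similarity 1 one_ne_zero (-(I * (δ : ℂ) / 2)))).carrier) δ) (a' δ))
                (bdryVertex (meshFaces third (((D.map (similarity I I_ne_zero 0)).map
                  (similarity 1 one_ne_zero (-(I * (δ : ℂ) / 2)))).carrier) δ) (b' δ)))) -
              ∫ γ, f γ.curve ∂(SAW.hexSAWLaw D.carrier δ (a δ) (b δ)))
          (𝓝[>] (0 : ℝ)) (𝓝 0)

/-- Stub 2a statement (v3.3; **boundary endpoint approximations for `O(δ)`-moving domains**, ∃-form): for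
every Dobrushin domain `D` and every family of sub-mesh translates `u δ` (`‖u δ‖ ≤ δ`, the hypotheses of route
SAWTrackTransport's robust limits `RL`) there are mid-edges `(a', b')`, eventually distinct boundary edges of the
face sets of the moving domains `D + u δ` on Glazman–Manolescu's hexagonal point `Θ ≡ π/3`, joined by a
Yang–Baxter walk of `(D + u δ)_δ`, whose rescaled midpoints converge to the marked points of `D`. (The fixed-domain
case `u ≡ 0` is the landed `stub_thirdBdryEndpoints`, p141015; the moving case translates its bulk set.)
[folklore] -/
def ShiftedBdryEndpoints : Prop :=
  ∀ (D : DobrushinDomain) (u : ℝ → ℂ), (∀ᶠ δ in 𝓝[>] (0 : ℝ), ‖u δ‖ ≤ δ) →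
    ∃ a' b' : ℝ → MidEdge,
      (∀ᶠ δ in 𝓝[>] (0 : ℝ), a' δ ≠ b' δ ∧
        IsBdryEdge (meshFaces third ((D.map (similarity 1 one_ne_zero (u δ))).carrier) δ) (a' δ) ∧
        IsBdryEdge (meshFaces third ((D.map (similarity 1 one_ne_zero (u δ))).carrier) δ) (b' δ) ∧
        Nonempty (YangBaxterSAW third ((D.map (similarity 1 one_ne_zero (u δ))).carrier) δ (a' δ) (b' δ))) ∧
      Tendsto (fun δ : ℝ => (δ : ℂ) * planeMidpoint third (a' δ)) (𝓝[>] (0 : ℝ)) (𝓝 (D.pt 0)) ∧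
      Tendsto (fun δ : ℝ => (δ : ℂ) * planeMidpoint third (b' δ)) (𝓝[>] (0 : ℝ)) (𝓝 (D.pt 1))

/-- Stub 2b statement (v3.3; **micro-robustness of the critical hexagonal chordal law, ∀-form** — the research
kernel of the line): for every hexagonal endpoint approximation `(a, b)` of `D` and EVERY pair of mid-edge families
`(a', b')` that are eventually distinct boundary edges of the face sets of the moving domains `S_δ(D) = σD − iδ/2`
joined by a Glazman–Manolescu walk, with rescaled midpoints converging to the marked points of `σD`, the critical
hexagonal law of the face domain of `S_δ(D)` at `a' δ` (⊆ `D`; inner-cell discretisation) between the boundary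
triangles of `a' δ`, `b' δ` and the critical hexagonal law of `D` between `a δ`, `b δ` merge on bounded
`1`-Lipschitz test functions. Under these hypotheses both laws are honest probability measures for small `δ`
(the face-domain side by `nonempty → hexagonal reachability`, no `w₂(π/3) = 0` junk). No source proves it.
[folklore] -/
def HexMicroRobustAll : Prop :=
  ∀ (D : DobrushinDomain) (a b : ℝ → HexVertex), SAW.IsEmbEndpointApprox hexGraph hexCenter D a b →
    ∀ a' b' : ℝ → MidEdge,
      (∀ᶠ δ in 𝓝[>] (0 : ℝ), a' δ ≠ b' δ ∧
        IsBdryEdge (meshFaces third (((D.map (similarity I I_ne_zero 0)).map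
          (similarity 1 one_ne_zero (-(I * (δ : ℂ) / 2)))).carrier) δ) (a' δ) ∧
        IsBdryEdge (meshFaces third (((D.map (similarity I I_ne_zero 0)).map
          (similarity 1 one_ne_zero (-(I * (δ : ℂ) / 2)))).carrier) δ) (b' δ) ∧
        Nonempty (YangBaxterSAW third (((D.map (similarity I I_ne_zero 0)).map
          (similarity 1 one_ne_zero (-(I * (δ : ℂ) / 2)))).carrier) δ (a' δ) (b' δ))) →
      Tendsto (fun δ : ℝ => (δ : ℂ) * planeMidpoint third (a' δ)) (𝓝[>] (0 : ℝ))
        (𝓝 ((D.map (similarity I I_ne_zero 0)).pt 0)) →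
      Tendsto (fun δ : ℝ => (δ : ℂ) * planeMidpoint third (b' δ)) (𝓝[>] (0 : ℝ))
        (𝓝 ((D.map (similarity I I_ne_zero 0)).pt 1)) →
      ∀ f : BoundedContinuousFunction (CurveClass ℂ) ℝ, LipschitzWith 1 f →
        Tendsto (fun δ : ℝ =>
            (∫ γ, f γ.curve ∂(SAW.hexSAWLaw
                (faceDomain (((D.map (similarity I I_ne_zero 0)).map
                  (similarity 1 one_ne_zero (-(I * (δ : ℂ) / 2)))).carrier) δ (a' δ)) δ
                (bdryVertex (meshFaces third (((D.map (similarity I I_ne_zero 0)).map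
                  (similarity 1 one_ne_zero (-(I * (δ : ℂ) / 2)))).carrier) δ) (a' δ))
                (bdryVertex (meshFaces third (((D.map (similarity I I_ne_zero 0)).map
                  (similarity 1 one_ne_zero (-(I * (δ : ℂ) / 2)))).carrier) δ) (b' δ)))) -
              ∫ γ, f γ.curve ∂(SAW.hexSAWLaw D.carrier δ (a δ) (b δ)))
          (𝓝[>] (0 : ℝ)) (𝓝 0)

/-- Stub 3 statement (**law-level Yang–Baxter transport `π/3 → π/2`, robust on the `π/3` side,
bounded-Lipschitz, ∃-form**): for every Dobrushin domain `D`, every family of sub-mesh shifts `u δ`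
(`‖u δ‖ ≤ δ`) and every pair of mid-edge families joined in the shifted domains `D + u δ` with rescaled
midpoints converging to the marked points of `D` (the hypotheses of route SAWTrackTransport's robust limits
`RL`, verbatim), there is a `π/2` endpoint approximation of `D` such that the critical GM laws at `π/3` (in
`D + u δ`) and at `π/2` (in `D`) merge on bounded `1`-Lipschitz test functions.
[cite: GlazmanManolescu2019, §4] [cite: DKKMO2020Rotational, Theorem 2.1 and Theorem 2.4] -/
def ThirdToSquareRobustBL : Prop :=
  ∀ (D : DobrushinDomain) (u : ℝ → ℂ) (a b : ℝ → MidEdge), (∀ᶠ δ in 𝓝[>] (0 : ℝ), ‖u δ‖ ≤ δ) →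
    (∀ᶠ δ in 𝓝[>] (0 : ℝ), Nonempty (YangBaxterSAW (fun (_ : ℤ) => Real.pi / 3)
      ((D.map (similarity 1 one_ne_zero (u δ))).carrier) δ (a δ) (b δ))) →
    Tendsto (fun δ : ℝ => (δ : ℂ) * planeMidpoint (fun (_ : ℤ) => Real.pi / 3) (a δ)) (𝓝[>] (0 : ℝ))
      (𝓝 (D.pt 0)) →
    Tendsto (fun δ : ℝ => (δ : ℂ) * planeMidpoint (fun (_ : ℤ) => Real.pi / 3) (b δ)) (𝓝[>] (0 : ℝ))
      (𝓝 (D.pt 1)) →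
    ∃ a' b' : ℝ → MidEdge, IsYBEndpointApprox (fun (_ : ℤ) => Real.pi / 2) D a' b' ∧
      ∀ f : BoundedContinuousFunction (CurveClass ℂ) ℝ, LipschitzWith 1 f →
        Tendsto (fun δ : ℝ =>
            (∫ γ, f (γ.curve (fun (_ : ℤ) => Real.pi / 3) δ)
                ∂(ybLaw (fun (_ : ℤ) => Real.pi / 3) ((D.map (similarity 1 one_ne_zero (u δ))).carrier) δ
                    1 (a δ) (b δ))) -
              ∫ γ, f (γ.curve (fun (_ : ℤ) => Real.pi / 2) δ)
                ∂(ybLaw (fun (_ : ℤ) => Real.pi / 2) D.carrier δ 1 (a' δ) (b' δ)))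
          (𝓝[>] (0 : ℝ)) (𝓝 0)

/-- Stub 2 statement (v4) = conjunct (ii) of `SAWTrackTransport.YBLimitExists` (stmt-CriticalPhenomena-16995): the
critical square-tiling Glazman–Manolescu walk has a ROBUST FULL chordal scaling limit — a chordal family `P` with
`RL(π/2) P`: for every Dobrushin domain `D`, every family of sub-mesh translates `D + u δ` (`‖u δ‖ ≤ δ`) and every family
of mid-edge endpoints joined in `(D + u δ)_δ` whose rescaled midpoints tend to the marked points, the law
`ybLaw (π/2) (D + u δ) δ 1 (a δ) (b δ)` pushed to `CurveClass ℂ` converges in law to `P D`. The limit is NOT identified.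
[cite: GlazmanManolescu2019, Thm 2] -/
def RobustSquareLimit : Prop :=
  ∃ P : ChordalFamily, P.IsChordal ∧ ∀ (D : DobrushinDomain) (u : ℝ → ℂ) (a b : ℝ → MidEdge), (∀ᶠ δ in 𝓝[>] (0 : ℝ), ‖u δ‖ ≤ δ) → (∀ᶠ δ in 𝓝[>] (0 : ℝ), Nonempty (YangBaxterSAW (fun (_ : ℤ) => Real.pi / 2) ((D.map (similarity 1 one_ne_zero (u δ))).carrier) δ (a δ) (b δ))) → Tendsto (fun δ : ℝ => (δ : ℂ) * planeMidpoint (fun (_ : ℤ) => Real.pi / 2) (a δ)) (𝓝[>] (0 : ℝ)) (𝓝 (D.pt 0)) → Tendsto (fun δ : ℝ => (δ : ℂ) * planeMidpoint (fun (_ : ℤ) => Real.pi / 2) (b δ)) (𝓝[>] (0 : ℝ)) (𝓝 (D.pt 1)) → TendstoLaw (fun δ (γ : YangBaxterSAW (fun (_ : ℤ) => Real.pi / 2) ((D.map (similarity 1 one_ne_zero (u δ))).carrier) δ (a δ) (b δ)) => γ.curve (fun (_ : ℤ) => Real.pi / 2) δ) (fun δ => ybLaw (fun (_ : ℤ) =>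 Real.pi / 2) ((D.map (similarity 1 one_ne_zero (u δ))).carrier) δ 1 (a δ) (b δ)) id (P D)

/-- Stub 1 statement (v4.1) — **VCR, vertex-convention robustness of the robust `π/3` limit** (the research kernel
at its weakest sufficient form): for every CHORDAL family `P` that is the robust full limit at `Θ ≡ π/3` of the critical
Glazman–Manolescu walk (`RL(π/3) P`: FACE discretisations of the moving domains `D + u δ`, `‖u δ‖ ≤ δ`, boundary mid-edge
endpoints), and for every Dobrushin domain `D` and every hexagonal endpoint approximation `(a, b)` of `D` (VERTEX
discretisation `embMeshDomain` of `D` on `δ·hexCenter`, endpoints of ANY admissible depth), the critical hexagonal chordal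
law of `D` between `a δ, b δ`, pushed along the quarter turn `σ z = i z`, converges in law to `P (σD)`. Implied by K2∀
(`vcr_of_allForm`); equivalent to it granted a chordal robust `π/3` limit (`allForm_iff_vcr`). No source proves it.
[folklore] -/
def HexVertexRobust : Prop :=
  ∀ P : ChordalFamily, P.IsChordal → (∀ (D : DobrushinDomain) (u : ℝ → ℂ) (a b : ℝ → MidEdge), (∀ᶠ δ in 𝓝[>] (0 : ℝ), ‖u δ‖ ≤ δ) → (∀ᶠ δ in 𝓝[>] (0 : ℝ), Nonempty (YangBaxterSAW (fun (_ : ℤ) => Real.pi / 3) ((D.map (similarity 1 one_ne_zero (u δ))).carrier) δ (a δ) (b δ))) → Tendsto (fun δ : ℝ => (δ : ℂ) * planeMidpoint (fun (_ : ℤ) => Real.pi / 3) (a δ)) (𝓝[>] (0 : ℝ)) (𝓝 (D.pt 0)) → Tendsto (fun δ : ℝ => (δ : ℂ) * planeMidpoint (fun (_ : ℤ) => Real.pi / 3) (b δ)) (𝓝[>] (0 : ℝ)) (𝓝 (D.pt 1)) → TendstoLaw (fun δ (γ : YangBaxterSAW (fun (_ : ℤ) => Real.pi / 3) ((D.map (similarity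 1 one_ne_zero (u δ))).carrier) δ (a δ) (b δ)) => γ.curve (fun (_ : ℤ) => Real.pi / 3) δ) (fun δ => ybLaw (fun (_ : ℤ) => Real.pi / 3) ((D.map (similarity 1 one_ne_zero (u δ))).carrier) δ 1 (a δ) (b δ)) id (P D)) → ∀ (D : DobrushinDomain) (a b : ℝ → HexVertex), SAW.IsEmbEndpointApprox hexGraph hexCenter D a b → TendstoLaw (fun δ (γ : SAW.HexDomainSAW D.carrier δ (a δ) (b δ)) => CurveClass.map (similarity I I_ne_zero 0 : C(ℂ, ℂ)) γ.curve) (fun δ => SAW.hexSAWLaw D.carrier δ (a δ) (b δ)) id (P (D.map (similarity I I_ne_zero 0)))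

/-- Stub 1a statement (v4.2) — **(E*) `HexEndpointRobust`, endpoint robustness of the critical hexagonal chordal law**
(hexagonal only, vertex convention, limit-free, no Yang–Baxter vocabulary): for every Dobrushin domain `D` and ANY TWO
hexagonal endpoint approximations `(a, b)`, `(a', b')` of `D` (any admissible depth), the critical hexagonal chordal
laws of `D` between `a δ, b δ` and between `a' δ, b' δ` merge on bounded `1`-Lipschitz test functions. A corollary of
the crux alone (`hexEndpointRobust_of_latticeUniversality`, p167072) and of (A) alone (`hexEndpointRobust_of_hexConjecture`).
[folklore] -/
def HexEndpointRobust : Prop :=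
  ∀ (D : DobrushinDomain) (a b a' b' : ℝ → HexVertex), SAW.IsEmbEndpointApprox hexGraph hexCenter D a b → SAW.IsEmbEndpointApprox hexGraph hexCenter D a' b' → ∀ f : BoundedContinuousFunction (CurveClass ℂ) ℝ, LipschitzWith 1 f → Tendsto (fun δ : ℝ => (∫ γ, f γ.curve ∂(SAW.hexSAWLaw D.carrier δ (a δ) (b δ))) - ∫ γ, f γ.curve ∂(SAW.hexSAWLaw D.carrier δ (a' δ) (b' δ))) (𝓝[>] (0 : ℝ)) (𝓝 0)

/-- Stub 1b statement (v4.2) — **(L*) `HexLayerRobust`, one good vertex approximation per domain** (∃-form): for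
every chordal `P` with `RL(π/3) P` and every Dobrushin domain `D`, SOME hexagonal endpoint approximation `(a, b)` of `D`
has σ-pushed vertex-convention critical hexagonal laws converging in law to `P (σD)`. Along the boundary-triangle tips
of the exact `π/3` dictionary it is the pure boundary-monolayer statement (inner-cell versus vertex discretisation of
one domain from the same endpoints). VCR → (L*) (`hexLayerRobust_of_hexVertexRobust`); (E*) → (L*) → VCR
(`hexVertexRobust_of_endpoint_layer`, p167072). [folklore] -/
def HexLayerRobust : Prop :=
  ∀ P : ChordalFamily, P.IsChordal → (∀ (D : DobrushinDomain) (u : ℝ → ℂ) (a b : ℝ → MidEdge), (∀ᶠ δ in 𝓝[>] (0 : ℝ), ‖u δ‖ ≤ δ) → (∀ᶠ δ in 𝓝[>] (0 : ℝ), Nonempty (YangBaxterSAW (fun (_ : ℤ) => Real.pi / 3) ((D.map (similarity 1 one_ne_zero (u δ))).carrier) δ (a δ) (b δ))) → Tendsto (fun δ : ℝ => (δ : ℂ) * planeMidpoint (fun (_ : ℤ) => Real.pi / 3) (a δ)) (𝓝[>] (0 : ℝ)) (𝓝 (D.pt 0)) → Tendsto (fun δ : ℝ => (δ : ℂ) *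 planeMidpoint (fun (_ : ℤ) => Real.pi / 3) (b δ)) (𝓝[>] (0 : ℝ)) (𝓝 (D.pt 1)) → TendstoLaw (fun δ (γ : YangBaxterSAW (fun (_ : ℤ) => Real.pi / 3) ((D.map (similarity 1 one_ne_zero (u δ))).carrier) δ (a δ) (b δ)) => γ.curve (fun (_ : ℤ) => Real.pi / 3) δ) (fun δ => ybLaw (fun (_ : ℤ) => Real.pi / 3) ((D.map (similarity 1 one_ne_zero (u δ))).carrier) δ 1 (a δ) (b δ)) id (P D)) → ∀ D : DobrushinDomain, ∃ a b : ℝ → HexVertex, SAW.IsEmbEndpointApprox hexGraph hexCenter D a b ∧ TendstoLaw (fun δ (γ : SAW.HexDomainSAW D.carrier δ (a δ) (b δ)) => CurveClass.map (similarity I I_ne_zero 0 : C(ℂ, ℂ)) γ.curve) (fun δ => SAW.hexSAWLaw D.carrier δ (a δ) (b δ)) id (P (D.map (similarity I I_ne_zero 0)))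

/-- Stub 5 statement (**the merging upgrade**, abstract, on `CurveClass ℂ`): two families of random curve
classes (measurable, under sub-probability laws) that merge on bounded `1`-Lipschitz test functions along
`𝓝[>] 0`, one of them tight along the mesh, merge on all bounded continuous test functions.
(D'Aristotile–Diaconis–Freedman 1988: under tightness all notions of merging coincide.) [folklore] -/
def MergingUpgrade : Prop :=
  ∀ (Ω₁ Ω₂ : ℝ → Type) [∀ δ, MeasurableSpace (Ω₁ δ)] [∀ δ, MeasurableSpace (Ω₂ δ)]
    (X : ∀ δ, Ω₁ δ → CurveClass ℂ) (Y : ∀ δ, Ω₂ δ → CurveClass ℂ)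
    (P : ∀ δ, Measure (Ω₁ δ)) (Q : ∀ δ, Measure (Ω₂ δ)),
    (∀ δ, Measurable (X δ)) → (∀ δ, Measurable (Y δ)) →
    (∀ δ, P δ Set.univ ≤ 1) → (∀ δ, Q δ Set.univ ≤ 1) →
    IsTightAlongMesh Y Q →
    (∀ f : BoundedContinuousFunction (CurveClass ℂ) ℝ, LipschitzWith 1 f →
      Tendsto (fun δ : ℝ => (∫ ω, f (X δ ω) ∂(P δ)) - ∫ ω, f (Y δ ω) ∂(Q δ)) (𝓝[>] (0 : ℝ)) (𝓝 0)) →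
    ∀ f : BoundedContinuousFunction (CurveClass ℂ) ℝ,
      Tendsto (fun δ : ℝ => (∫ ω, f (X δ ω) ∂(P δ)) - ∫ ω, f (Y δ ω) ∂(Q δ)) (𝓝[>] (0 : ℝ)) (𝓝 0)

/-! ### Registered stubs v4.5 (the ONLY sorries of this file; headers unfolded) -/

/-- Stub 1a (v4.2, RESEARCH; promoted by c5): **(E*) `HexEndpointRobust`** unfolded — any two hexagonal endpoint
approximations of one Dobrushin domain give critical chordal laws (vertex convention) merging on bounded `1`-Lipschitz
test functions. Necessary for the crux unconditionally (`hexEndpointRobust_of_latticeUniversality`, p167072); implied by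
(A) (`hexEndpointRobust_of_hexConjecture`); no (A)-free source ("forgetting of the microscopic start",
`K2-ANALYSIS-c2.md` §3, `PROMOTE-addendum-c5.md`). -/
theorem stub_hexEndpointRobust : ∀ (D : DobrushinDomain) (a b a' b' : ℝ → HexVertex), SAW.IsEmbEndpointApprox hexGraph hexCenter D a b → SAW.IsEmbEndpointApprox hexGraph hexCenter D a' b' → ∀ f : BoundedContinuousFunction (CurveClass ℂ) ℝ, LipschitzWith 1 f → Tendsto (fun δ : ℝ => (∫ γ, f γ.curve ∂(SAW.hexSAWLaw D.carrier δ (a δ) (b δ))) - ∫ γ, f γ.curve ∂(SAW.hexSAWLaw D.carrier δ (a' δ) (b' δ))) (𝓝[>] (0 : ℝ)) (𝓝 0) := by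
  sorry

/-- Stub 1b (v4.3, RESEARCH, lead holds): **(MONO) `HexMonolayer`, the boundary-monolayer statement made concrete**
(hexagonal model only; P-free, limit-free, ONE approximation type): for every Dobrushin domain `D` and every family of
eventually-distinct boundary mid-edges `(a', b')` of the face sets of the moving domains `S_δ(D) = σD − iδ/2` joined by a
Glazman–Manolescu walk, with rescaled midpoints converging to the marked points of `σD`, WHOSE BOUNDARY-TRIANGLE TIPS form an
admissible hexagonal endpoint approximation of `D`, the critical hexagonal chordal laws of (i) the FACE DOMAIN of `S_δ(D)` at
`a' δ` (`⊆ D`; inner-cell discretisation of `D`) and of (ii) `D` itself (vertex discretisation `embMeshDomain`), BOTH between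
the SAME tips, merge on bounded `1`-Lipschitz test functions. It is the diagonal `(a, b) := tips` of the twice-promoted K2∀
(`stub_hexMicroRobustAll` of v3.4: K2∀ → MONO trivially), hence necessary for the crux granted stubs 2–4
(crux → VCR → K2∀, p165464/p157085); with (E*) and the provable stub 1c it gives (L*) and VCR back (stub 1d). No source:
in total variation it is false (the first step from a tip enters the monolayer `V ∖ C` with probability ≈ 1/3); in law it is
"forgetting of the boundary monolayer" (`K2-ANALYSIS-c2.md` §3 (L), `PROMOTE-addendum-c5.md` §3). -/
theorem stub_hexMonolayer : ∀ (D : DobrushinDomain) (a' b' : ℝ → MidEdge), (∀ᶠ δ in 𝓝[>] (0 : ℝ), a' δ ≠ b' δ ∧ IsBdryEdge (meshFaces third (((D.map (similarity I I_ne_zero 0)).map (similarity 1 one_ne_zero (-(I * (δ : ℂ) / 2)))).carrier) δ) (a' δ) ∧ IsBdryEdge (meshFaces third (((D.map (similarity I I_ne_zero 0)).map (similarity 1 one_ne_zero (-(I * (δ : ℂ) / 2)))).carrier) δ) (b' δ) ∧ Nonempty (YangBaxterSAW third (((D.map (similarity I I_ne_zero 0)).map (similarity 1 one_ne_zero (-(I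 * (δ : ℂ) / 2)))).carrier) δ (a' δ) (b' δ))) → Tendsto (fun δ : ℝ => (δ : ℂ) * planeMidpoint third (a' δ)) (𝓝[>] (0 : ℝ)) (𝓝 ((D.map (similarity I I_ne_zero 0)).pt 0)) → Tendsto (fun δ : ℝ => (δ : ℂ) * planeMidpoint third (b' δ)) (𝓝[>] (0 : ℝ)) (𝓝 ((D.map (similarity I I_ne_zero 0)).pt 1)) → SAW.IsEmbEndpointApprox hexGraph hexCenter D (fun δ => (bdryVertex (meshFaces third (((D.map (similarity I I_ne_zero 0)).map (similarity 1 one_ne_zero (-(I * (δ : ℂ) / 2)))).carrier) δ) (a' δ))) (fun δ => (bdryVertex (meshFaces third (((D.map (similarity I I_ne_zero 0)).map (similarity 1 one_ne_zero (-(I * (δ : ℂ) / 2)))).carrier) δ) (b' δ))) → ∀ f : BoundedContinuousFunction (CurveClass ℂ) ℝ, LipschitzWith 1 f → Tendsto (fun δ : ℝ => (∫ γ, f γ.curve ∂(SAW.hexSAWLaw (faceDomain (((D.map (similarity I I_ne_zero 0)).map (similarity 1 one_ne_zero (-(I * (δ : ℂ) / 2)))).carrier) δ (a' δ)) δ (bdryVertex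 (meshFaces third (((D.map (similarity I I_ne_zero 0)).map (similarity 1 one_ne_zero (-(I * (δ : ℂ) / 2)))).carrier) δ) (a' δ)) (bdryVertex (meshFaces third (((D.map (similarity I I_ne_zero 0)).map (similarity 1 one_ne_zero (-(I * (δ : ℂ) / 2)))).carrier) δ) (b' δ)))) - ∫ γ, f γ.curve ∂(SAW.hexSAWLaw D.carrier δ (bdryVertex (meshFaces third (((D.map (similarity I I_ne_zero 0)).map (similarity 1 one_ne_zero (-(I * (δ : ℂ) / 2)))).carrier) δ) (a' δ)) (bdryVertex (meshFaces third (((D.map (similarity I I_ne_zero 0)).map (similarity 1 one_ne_zero (-(I * (δ : ℂ) / 2)))).carrier) δ) (b' δ)))) (𝓝[>] (0 : ℝ)) (𝓝 0) := by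
  sorry

/- Stub 1c `stub_admissibleTips` (a bulk-attached boundary approximation of the face sets of `S_δ(D)` whose tips are an
admissible hexagonal endpoint approximation of `D`) is CLOSED: landed by worker W1 as
`Theorems/SAWMassiveIsingTiltLatticeUniversalityAdmissibleTips.lean` (+ `…AdmissibleTipsBulk.lean`, p172912) and imported above under
its registered name. -/

/- Stub 1d `stub_monolayerGlue` (MONO → AdmissibleTips → (L*)) is CLOSED: landed by worker W2 as
`Theorems/SAWMassiveIsingTiltLatticeUniversalityMonolayerGlue.lean` (p172557, with the reusable pointwise convention bridge
`hexThirdShiftBL_at`) and imported above under its registered name. -/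

/-- **(L*) `HexLayerRobust` (v4.2's stub 1b) DERIVED from stubs 1b–1d**: one good vertex approximation per domain — the
tips of stub 1c, good by the monolayer statement. [folklore] -/
theorem hexLayerRobust_of_stubs' : ∀ P : ChordalFamily, P.IsChordal → (∀ (D : DobrushinDomain) (u : ℝ → ℂ) (a b : ℝ → MidEdge), (∀ᶠ δ in 𝓝[>] (0 : ℝ), ‖u δ‖ ≤ δ) → (∀ᶠ δ in 𝓝[>] (0 : ℝ), Nonempty (YangBaxterSAW (fun (_ : ℤ) => Real.pi / 3) ((D.map (similarity 1 one_ne_zero (u δ))).carrier) δ (a δ) (b δ))) → Tendsto (fun δ : ℝ => (δ : ℂ) * planeMidpoint (fun (_ : ℤ) => Real.pi / 3) (a δ)) (𝓝[>] (0 : ℝ)) (𝓝 (D.pt 0)) → Tendsto (fun δ : ℝ => (δ : ℂ) * planeMidpoint (fun (_ : ℤ) => Real.pi / 3) (b δ)) (𝓝[>] (0 : ℝ)) (𝓝 (D.pt 1)) → TendstoLaw (fun δ (γ : YangBaxterSAW (fun (_ : ℤ) => Real.pi / 3) ((D.map (similarity 1 one_ne_zero (u δ))).carrier) δ (a δ)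 (b δ)) => γ.curve (fun (_ : ℤ) => Real.pi / 3) δ) (fun δ => ybLaw (fun (_ : ℤ) => Real.pi / 3) ((D.map (similarity 1 one_ne_zero (u δ))).carrier) δ 1 (a δ) (b δ)) id (P D)) → ∀ D : DobrushinDomain, ∃ a b : ℝ → HexVertex, SAW.IsEmbEndpointApprox hexGraph hexCenter D a b ∧ TendstoLaw (fun δ (γ : SAW.HexDomainSAW D.carrier δ (a δ) (b δ)) => CurveClass.map (similarity I I_ne_zero 0 : C(ℂ, ℂ)) γ.curve) (fun δ => SAW.hexSAWLaw D.carrier δ (a δ) (b δ)) id (P (D.map (similarity I I_ne_zero 0))) :=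
  stub_monolayerGlue stub_hexMonolayer stub_admissibleTips

/-- **VCR (v4.1's stub 1) DERIVED from stubs 1a–1b**: (E*) → (L*) → VCR (`hexVertexRobust_of_endpoint_layer`, p167072:
bounded-Lipschitz merging against the convergent good approximation + the convergent upgrade; `σ` is an isometry).
[folklore] -/
theorem hexVertexRobust_of_stubs : HexVertexRobust :=
  hexVertexRobust_of_endpoint_layer stub_hexEndpointRobust hexLayerRobust_of_stubs'

/-- Stub 2 (v4; = conjunct (ii) of item stmt-CriticalPhenomena-16995 `YBLimitExists` of route SAWTrackTransport, verbatim
body; open-problem, staffed there — `robustSquareLimit_of_ybLimitExists` below): the critical square-tiling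
Glazman–Manolescu walk has a robust full chordal scaling limit — unfolded `RobustSquareLimit`. -/
theorem stub_ybRobustLimit : ∃ P : ChordalFamily, P.IsChordal ∧ ∀ (D : DobrushinDomain) (u : ℝ → ℂ) (a b : ℝ → MidEdge), (∀ᶠ δ in 𝓝[>] (0 : ℝ), ‖u δ‖ ≤ δ) → (∀ᶠ δ in 𝓝[>] (0 : ℝ), Nonempty (YangBaxterSAW (fun (_ : ℤ) => Real.pi / 2) ((D.map (similarity 1 one_ne_zero (u δ))).carrier) δ (a δ) (b δ))) → Tendsto (fun δ : ℝ => (δ : ℂ) * planeMidpoint (fun (_ : ℤ) => Real.pi / 2) (a δ)) (𝓝[>] (0 : ℝ)) (𝓝 (D.pt 0)) → Tendsto (fun δ : ℝ => (δ : ℂ) * planeMidpoint (fun (_ : ℤ) => Real.pi / 2) (b δ)) (𝓝[>] (0 : ℝ)) (𝓝 (D.pt 1)) → TendstoLaw (fun δ (γ : YangBaxterSAW (fun (_ : ℤ) => Real.pi / 2) ((D.map (similarity 1 one_ne_zero (u δ))).carrier) δ (a δ) (b δ)) => γ.curve (fun (_ : ℤ) => Real.pi / 2) δ) (fun δ =>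 ybLaw (fun (_ : ℤ) => Real.pi / 2) ((D.map (similarity 1 one_ne_zero (u δ))).carrier) δ 1 (a δ) (b δ)) id (P D) := by
  sorry

/-- Stub 3 (v4; = item stmt-CriticalPhenomena-16963 of route SAWTrackTransport, verbatim; open-problem, staffed there):
angle universality of the robust full limit inside the Yang–Baxter family, `RL(π/2) P → RL(α) P` for
`α ∈ [π/3, 2π/3]` (DKKMO's scheme at `n = 0`). -/
theorem stub_angleUniversality : SAWTrackTransport.AngleUniversality := by
  sorry

/-- Stub 4 (= item stmt-CriticalPhenomena-16966 of route SAWTrackTransport, verbatim; open-problem): the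
off-family toll, square-tiling Yang–Baxter law ↔ uniform critical `δℤ²` law. -/
theorem stub_ybToUniform : SAWTrackTransport.YBtoUniform := by
  sorry

/- CLOSED and imported (landed supports of this item): `stub_thirdEndpoints` (W1, p144205), `stub_mergingUpgrade`
(W2, p144690), `stub_shiftedBdryEndpoints` (W3, p147051), the face-law sanity lemma (W4, p149666); glue p143793
(rotated relay), p144803 (shifted relay), p150118 (all-form relay), p150474 (face nesting), p153935 (convergent
upgrade), p154406 (kernel under (A)), v4's `…NoTightness.lean` (p156087) and `…KernelUnderTransport.lean` (W1, p157085).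
GONE: `stub_hexTight` (= stmt-5423), `stub_thirdToSquareRobustBL` (follows from stubs 2–3, below), `stub_hexMicroRobustAll`
(K2∀, the stronger typing of stub 1: `latticeUniversality_of_K2stubs` below). -/

/-! ### The composition v4: the four stub STATEMENTS imply the crux (sorry-free, landed) -/

/-- **`HexVertexRobust → RobustSquareLimit → AngleUniversality → YBtoUniform → LatticeUniversality`** — the crux body
from the four v4.1 stub statements (written out; with K2∀ in place of VCR it is landed as
`latticeUniversality_of_allForm_robustSquare`, `Theorems/SAWMassiveIsingTiltLatticeUniversalityNoTightness.lean`): exact quarter turn at the `δℤ²` end, toll in `σD`,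
`RL(π/2)` at `u ≡ 0` along the landed compass approximation, and (HexVL) = K2∀ + exact `π/3` dictionary + free `iδ/2`
displacement + `RL(π/3)` + the convergent upgrade. No tightness, no (A). [folklore] -/
theorem LatticeUniversality_of_stubs (h1 : HexVertexRobust) (h2 : RobustSquareLimit)
    (h3 : SAWTrackTransport.AngleUniversality) (h4 : SAWTrackTransport.YBtoUniform) :
    SAWMassiveIsingTilt.LatticeUniversality := by
  intro D a b a' b' hab hab' f
  -- the robust square-tiling limit `P`, transferred to `π/3` by angle universality
  obtain ⟨P, hPch, hRL2⟩ := h2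
  have hmem : Real.pi / 3 ∈ Set.Icc (Real.pi / 3) (2 * Real.pi / 3) := ⟨le_rfl, by linarith [Real.pi_pos]⟩
  have hRL3 := h3 (Real.pi / 3) hmem P hPch hRL2
  -- the rotated `δℤ²` approximation of `σD`; the compass approximation of `σD` on the square tiling
  have habσ := Cruxes.HexTransfer.PinTheShear.stub_quarterTurnCovariance.2 D a b hab
  obtain ⟨a₂, b₂, hab₂⟩ :=
    Cruxes.HexTransfer.Sketch.stub_compassEndpoints (D.map (similarity I I_ne_zero 0))
  -- the transported test function `g = f ∘ σ⁻¹`, with `g (σ c) = f c`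
  set g : BoundedContinuousFunction (CurveClass ℂ) ℝ := f.compContinuous
    ⟨CurveClass.map (similarity (-I) (neg_ne_zero.2 I_ne_zero) 0 : C(ℂ, ℂ)),
      (CurveClass.lipschitzWith_map
        (lipschitzWith_similarity (-I) (neg_ne_zero.2 I_ne_zero) 0)).continuous⟩ with hg_def
  have hg : ∀ c, g (CurveClass.map (similarity I I_ne_zero 0 : C(ℂ, ℂ)) c) = f c := fun c => by
    simp only [hg_def, BoundedContinuousFunction.compContinuous_apply, ContinuousMap.coe_mk, map_negI_map_I]
  -- bracket 1: the toll in `σD` on `g` (stub 4)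
  have hZ := h4 (D.map (similarity I I_ne_zero 0)) (fun δ => ![-(a δ 1), a δ 0])
    (fun δ => ![-(b δ 1), b δ 0]) a₂ b₂ habσ hab₂ g
  -- bracket 2: the square-tiling laws of `σD` converge to `P (σD)` (stub 2 at `u ≡ 0`)
  have h2' := Cruxes.HexTransfer.YbRelay.tendstoLaw_of_robustLimit (Real.pi / 2) P hRL2
    (D.map (similarity I I_ne_zero 0)) a₂ b₂ hab₂ g
  -- bracket 3: (HexVL) — the hexagonal laws of `D`, pushed along `σ`, converge to `P (σD)` (stub 1 = VCR)
  have hX := h1 P hPch hRL3 D a' b' hab' g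
  -- assemble
  have h := (hZ.add h2').sub hX
  rw [zero_add, sub_self] at h
  refine h.congr fun δ => ?_
  have hq : ∫ γ, g γ.curve ∂(SAW.law (D.map (similarity I I_ne_zero 0)).carrier δ ![-(a δ 1), a δ 0]
      ![-(b δ 1), b δ 0]) = ∫ γ, g (CurveClass.map (similarity I I_ne_zero 0 : C(ℂ, ℂ)) γ.curve)
        ∂(SAW.law D.carrier δ (a δ) (b δ)) :=
    integral_quarterTurn D.carrier δ (a δ) (b δ) g
  simp only [hg] at hq ⊢
  linarith [hq]

/-- **The crux from the line's registered stubs**, concluded BY NAME (route `SAWMassiveIsingTilt`, item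
stmt-CriticalPhenomena-0807). -/
theorem LatticeUniversality_of : SAWMassiveIsingTilt.LatticeUniversality :=
  LatticeUniversality_of_stubs hexVertexRobust_of_stubs stub_ybRobustLimit stub_angleUniversality stub_ybToUniform

/-- The v4.2 composition in arrow form, as landed (`latticeUniversality_of_endpointLayerRobustSquare`, p167072):
(E*) → (L*) → RobustSquareLimit → AngleUniversality → YBtoUniform → LatticeUniversality. [folklore] -/
theorem LatticeUniversality_of' : SAWMassiveIsingTilt.LatticeUniversality :=
  latticeUniversality_of_endpointLayerRobustSquare stub_hexEndpointRobust hexLayerRobust_of_stubs' stub_ybRobustLimit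
    stub_angleUniversality stub_ybToUniform

/-- The same term closes route `SAWHexUniversality`'s copy of the crux (identical body). -/
theorem latticeUniversality_hexUniversality : SAWHexUniversality.LatticeUniversality := LatticeUniversality_of

/-- The same term closes route `SAWResidueField`'s copy of the crux (identical body). -/
theorem latticeUniversality_residueField : SAWResidueField.LatticeUniversality := LatticeUniversality_of

/-- The same term closes route `SAWBetheAnsatz`'s copy of the crux (identical body). -/
theorem latticeUniversality_betheAnsatz : SAWBetheAnsatz.LatticeUniversality := LatticeUniversality_of

/-- The same term closes route `SAWLatticeVirasoro`'s copy of the crux (identical body). -/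
theorem latticeUniversality_latticeVirasoro : SAWLatticeVirasoro.LatticeUniversality := LatticeUniversality_of

/-- The same term closes route `SAWTiltedExplorer`'s copy of the crux (identical body). -/
theorem latticeUniversality_tiltedExplorer : SAWTiltedExplorer.LatticeUniversality := LatticeUniversality_of

/-- The same term closes route `SAWTurnDefect`'s copy of the crux (identical body). -/
theorem latticeUniversality_turnDefect : SAWTurnDefect.LatticeUniversality := LatticeUniversality_of

/-! ### Sanity (sorry-free): where the v4 stubs sit, and what v3.4's stubs became -/

/-- Stub 2 IS conjunct (ii) of `SAWTrackTransport.YBLimitExists` (stmt-16995): it closes the moment that item does.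
[folklore] -/
theorem robustSquareLimit_of_ybLimitExists (h : SAWTrackTransport.YBLimitExists) : RobustSquareLimit := h.2

/-- **v3.4's transport stub from v4's stubs 2–3** (`RobustSquareLimit → AngleUniversality → ThirdToSquareRobustBL`):
the robust limit at `π/3` sends the laws of the moving domains `D + u δ` to `P D`, the robust limit at `π/2` at
`u ≡ 0` sends the laws of `D` along the landed compass approximation to `P D`; subtract (as in p144803's
`thirdToSquareRobustBL_of_trackTransport`, minus the unused endpoint clause (i) of 16995). [folklore] -/
theorem thirdToSquareRobustBL_of_v4stubs (hL : RobustSquareLimit) (hAU : SAWTrackTransport.AngleUniversality) :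
    ThirdToSquareRobustBL := by
  intro D u a b hu hne ha hb
  obtain ⟨a', b', hab'⟩ := Cruxes.HexTransfer.Sketch.stub_compassEndpoints D
  refine ⟨a', b', hab', fun f _ => ?_⟩
  obtain ⟨P, hPch, hconv2⟩ := hL
  have hmem : Real.pi / 3 ∈ Set.Icc (Real.pi / 3) (2 * Real.pi / 3) := ⟨le_rfl, by linarith [Real.pi_pos]⟩
  have hconv3 := hAU (Real.pi / 3) hmem P hPch hconv2
  have h3 := hconv3 D u a b hu hne ha hb f
  have h2 := Cruxes.HexTransfer.YbRelay.tendstoLaw_of_robustLimit (Real.pi / 2) P hconv2 D a' b' hab' f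
  have hsub := h3.sub h2
  rwa [sub_self] at hsub

/-- **v3.4's composition stays available**: `HexTight → K2∀ → ThirdToSquareRobustBL → YBtoUniform →
LatticeUniversality` (landed `latticeUniversality_of_allFormRelay`, p150118) — the fallback if the transport is ever
proved LIMIT-FREE in difference form (then the upgrade needs the tightness crux stmt-5423 again). [folklore] -/
theorem latticeUniversality_of_v34stubs (hT : HexTightStmt) (h1 : HexMicroRobustAll) (h2 : ThirdToSquareRobustBL)
    (h3 : SAWTrackTransport.YBtoUniform) : SAWMassiveIsingTilt.LatticeUniversality :=
  latticeUniversality_of_allFormRelay hT h1 h2 h3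

/-- **By-product of stubs 1–3 for the hexagonal model alone**: the critical hexagonal SAW in the VERTEX convention —
every Dobrushin domain, every hexagonal endpoint approximation — has a full chordal scaling limit, `D ↦ P(σD)` seen
through the quarter turn `σ` (unidentified, no (A), no tightness). [folklore] -/
theorem hexLimit_of_stubs : ∃ P : ChordalFamily, P.IsChordal ∧ ∀ (D : DobrushinDomain) (a b : ℝ → HexVertex),
    SAW.IsEmbEndpointApprox hexGraph hexCenter D a b →
    TendstoLaw (fun δ (γ : SAW.HexDomainSAW D.carrier δ (a δ) (b δ)) =>
        CurveClass.map (similarity I I_ne_zero 0 : C(ℂ, ℂ)) γ.curve)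
      (fun δ => SAW.hexSAWLaw D.carrier δ (a δ) (b δ)) id (P (D.map (similarity I I_ne_zero 0))) := by
  obtain ⟨P, hPch, hRL2⟩ := stub_ybRobustLimit
  have hmem : Real.pi / 3 ∈ Set.Icc (Real.pi / 3) (2 * Real.pi / 3) := ⟨le_rfl, by linarith [Real.pi_pos]⟩
  exact ⟨P, hPch, hexVertexRobust_of_stubs P hPch (stub_angleUniversality (Real.pi / 3) hmem P hPch hRL2)⟩

/-- **K2∀ → VCR**: v3.3–v4's kernel implies v4.1's (landed `tendstoLaw_hexLaw_of_allForm_robustThird`, p156087; arrow form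
`vcr_of_allForm`) — so a proof of the promoted K2∀ still closes stub 1. [folklore] -/
theorem hexVertexRobust_of_allForm (hK : HexMicroRobustAll) : HexVertexRobust :=
  fun P hPch hRL3 => tendstoLaw_hexLaw_of_allForm_robustThird hK P hPch hRL3

/-- **Stubs 1–3 give K2∀ back** (worker W1's `allForm_of_vcr_robustThird`, p157085): granted the chordal robust `π/3`
limit of stubs 2–3, VCR and K2∀ are equivalent. [folklore] -/
theorem allForm_of_stubs : HexMicroRobustAll := by
  obtain ⟨P, hPch, hRL2⟩ := stub_ybRobustLimit
  have hmem : Real.pi / 3 ∈ Set.Icc (Real.pi / 3) (2 * Real.pi / 3) := ⟨le_rfl, by linarith [Real.pi_pos]⟩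
  have hRL3 := stub_angleUniversality (Real.pi / 3) hmem P hPch hRL2
  exact allForm_of_vcr_robustThird P hPch hRL3 (hexVertexRobust_of_stubs P hPch hRL3)

/-- (E*) and (L*) ARE the registered stubs 1a–1b (folded names). [folklore] -/
theorem hexEndpointRobust_of_stubs : HexEndpointRobust := stub_hexEndpointRobust

/-- (L*) IS the registered stub 1b (folded name). [folklore] -/
theorem hexLayerRobust_of_stubs : HexLayerRobust := hexLayerRobust_of_stubs'

/-- **(E*) is a corollary of the crux** (p167072): whatever closes stmt-0807 closes stub 1a. [folklore] -/
theorem hexEndpointRobust_of_crux (hU : SAWMassiveIsingTilt.LatticeUniversality) : HexEndpointRobust :=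
  hexEndpointRobust_of_latticeUniversality hU

/-- **Granted stubs 2–4, the crux is EQUIVALENT to stubs 1a ∧ 1b** (`latticeUniversality_iff_endpoint_layer`,
p167072): the hexagonal kernel of the line cannot be weakened further on this relay. [folklore] -/
theorem latticeUniversality_iff_stubs12 :
    SAWMassiveIsingTilt.LatticeUniversality ↔ (HexEndpointRobust ∧ HexLayerRobust) :=
  latticeUniversality_iff_endpoint_layer stub_ybRobustLimit stub_angleUniversality stub_ybToUniform

/-- **v4's composition (K2∀-typed kernel) stays available**: `HexMicroRobustAll → RobustSquareLimit → AngleUniversality →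
YBtoUniform → LatticeUniversality`. [folklore] -/
theorem latticeUniversality_of_K2stubs (hK : HexMicroRobustAll) (h2 : RobustSquareLimit)
    (h3 : SAWTrackTransport.AngleUniversality) (h4 : SAWTrackTransport.YBtoUniform) :
    SAWMassiveIsingTilt.LatticeUniversality :=
  LatticeUniversality_of_stubs (hexVertexRobust_of_allForm hK) h2 h3 h4

/-- v3.2's ∃-form `HexMicroRobust` from the kernel (landed `hexMicroRobust_of_allForm`, p150118, with the boundary
approximation of `stub_shiftedBdryEndpoints`, p147051). [folklore] -/
theorem hexMicroRobust_of_stubs : HexMicroRobust := hexMicroRobust_of_allForm allForm_of_stubs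

/-- The convention bridge `HexThirdShiftBL` from the kernel (landed `hexThirdShiftBL_of_microRobust`, p144803).
[cite: GlazmanManolescu2019, §1 p. 3 and Fig. 2] -/
theorem hexThirdShiftBL_of_stubs : HexThirdShiftBL := hexThirdShiftBL_of_microRobust hexMicroRobust_of_stubs

/-- **The ∀-form kernel's hypotheses are honest** (v3.4 sanity, worker W4, p149666): for every `(a', b')` satisfying
the eventual clause of `stub_hexMicroRobustAll`, the face-domain hexagonal law IS a probability measure for all
small `δ` (a GM walk between distinct boundary edges gives hexagonal reachability of the two boundary-triangle tips;
finiteness by boundedness) — no `w₂(π/3) = 0` junk corner. [folklore] -/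
theorem faceLaw_isProbabilityMeasure_eventually (D : DobrushinDomain) (a' b' : ℝ → MidEdge)
    (h : ∀ᶠ δ in 𝓝[>] (0 : ℝ), a' δ ≠ b' δ ∧
      IsBdryEdge (meshFaces third (((D.map (similarity I I_ne_zero 0)).map
        (similarity 1 one_ne_zero (-(I * (δ : ℂ) / 2)))).carrier) δ) (a' δ) ∧
      IsBdryEdge (meshFaces third (((D.map (similarity I I_ne_zero 0)).map
        (similarity 1 one_ne_zero (-(I * (δ : ℂ) / 2)))).carrier) δ) (b' δ) ∧
      Nonempty (YangBaxterSAW third (((D.map (similarity I I_ne_zero 0)).map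
        (similarity 1 one_ne_zero (-(I * (δ : ℂ) / 2)))).carrier) δ (a' δ) (b' δ))) :
    ∀ᶠ δ : ℝ in 𝓝[>] (0 : ℝ), IsProbabilityMeasure (SAW.hexSAWLaw
      (faceDomain (((D.map (similarity I I_ne_zero 0)).map
        (similarity 1 one_ne_zero (-(I * (δ : ℂ) / 2)))).carrier) δ (a' δ)) δ
      (bdryVertex (meshFaces third (((D.map (similarity I I_ne_zero 0)).map
        (similarity 1 one_ne_zero (-(I * (δ : ℂ) / 2)))).carrier) δ) (a' δ))
      (bdryVertex (meshFaces third (((D.map (similarity I I_ne_zero 0)).map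
        (similarity 1 one_ne_zero (-(I * (δ : ℂ) / 2)))).carrier) δ) (b' δ))) :=
  eventually_isProbabilityMeasure_faceLaw D a' b' h

/-- v3.4's stub 1 statement IS the crux `HexTight` of routes SAWDefectDecoherence / SAWDevelopingMap (stmt-5423) — no
longer a stub of this line. [folklore] -/
theorem hexTightStmt_iff : HexTightStmt ↔ SAWDefectDecoherence.HexTight := Iff.rfl

/-- The `π/3` endpoint hypothesis of `RL(π/3)` is non-vacuous in every Dobrushin domain (landed `stub_thirdEndpoints`,
p144205; sanity — the composition itself takes its `π/3` approximation from the kernel's dictionary step). [folklore] -/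
theorem isYBEndpointApprox_third_nonvacuous (D : DobrushinDomain) :
    ∃ a b : ℝ → MidEdge, IsYBEndpointApprox (fun (_ : ℤ) => Real.pi / 3) D a b :=
  stub_thirdEndpoints D

end Summit.CriticalPhenomena.SAWScalingLimit.Cruxes.LatticeUniversality.Birth

end
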